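import Literature.NumberTheory.LFunctions.Zhang2022.RepairGapLemma84LeafPremise
import Literature.NumberTheory.LFunctions.Zhang2022.RepairGapLemma83RelFree
import HarnessLib

/-!
# Zhang (2022), rescue GAP/BED (D-0124 (3)(4)): the Lemma 8.3 and Lemma 8.4 LEAVES of `theorem1_of_leaves`
# under the minimum premise `‖L(1,χ)‖ ≤ 𝓛⁻¹⁵` — UNCONDITIONAL

Topic `Literature/NumberTheory/LFunctions/Zhang2022` (Landau–Siegel audit tree; verdict-neutral).
Y. Zhang, *Discrete mean estimates and the Landau–Siegel zero*, arXiv:2211.02515v1 (2022)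
[Zhang2022LandauSiegel] — **an unrefereed manuscript under adjudication; nothing in this file asserts or
denies its Theorems 1–2, and nothing here is a claim about Landau–Siegel zeros. The programme SEARCHES and
TYPES; no claim about Landau–Siegel zeros, Theorems 1–2 of arXiv:2211.02515 or a repaired Margin232 until a
kernel theorem says so.**

Closes the one Part-II leaf of node group 2 that was still conditional at (A)-exponent 15 (rescue GAP row G-31;
the tree edge `Lemma84.lemma84Rel_pow15_of_lemma83Rel_pow15`, file `RepairGapLemma84LeafPremise`, took Lemma 8.3
(relative) under the `𝓛⁻¹⁵` guard as a hypothesis). The Appendix A chain behind `Skeleton.lemma83Rel_holds` has now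
been re-run GUARD-FREE (`Repair.Gap.lemma83Rel_free`, file `RepairGapLemma83RelFree`, over
`RepairGapAppendixALocalFree` / `…CaseOneFree` / `…PowSumFree`), so:

* `Skeleton.lemma83Rel_pow15` — the body of the leaf `Skeleton.Lemma83Rel c′` with its guard `AssumptionA D χ`
  replaced by `‖L(1,χ)‖ ≤ 𝓛⁻¹⁵` (indeed by anything: `lemma83Rel_of_assumptionAWith` for EVERY real exponent `E`),
  every `c′`;
* `Skeleton.lemma84Rel_pow15` — **the body of the leaf `Skeleton.Lemma84Rel c′` (§8 p. 47, GAP row G-adj1-1; binder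
  `h84` of `theorem1_of_leaves`) with its guard replaced by `‖L(1,χ)‖ ≤ 𝓛⁻¹⁵`, UNCONDITIONAL**, every `c′`, same
  constant `C_fin` as the edge; `lemma84Rel_of_assumptionAWith` — under `Repair.Bed.AssumptionAWith E` for every
  real `E ≥ 15` (at the printed `E = 2022` this is the body of the tree theorem `Skeleton.lemma84Rel_holds`, not
  restated).

With `Skeleton.lemma82_pow15` (p592479) and `Lemma101.lemma101_pow15` (p592343): the leaves 8.2, 8.3, 8.4, 10.1 of
node group 2 are kernel at (A)-exponent 15; Lemma 10.2 (`Lemma102RelW`) is not treated here. Theorems only (one-line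
compositions); no definition, no named fact; nothing about (A) itself.

## References

* Y. Zhang, arXiv:2211.02515v1 (2022), §8 Lemmas 8.3–8.4 (pp. 17, 46–47); App. A pp. 101–103.
  [cite: Zhang2022LandauSiegel, §8 Lemmas 8.3–8.4]
-/

noncomputable section

open Complex Real Finset

namespace Literature.NumberTheory.LFunctions.Zhang2022.Skeleton

open Literature.NumberTheory.LFunctions.Zhang2022
open Literature.NumberTheory.LFunctions.Zhang2022.Repair.Bed (AssumptionAWith)

/-- **Lemma 8.3 (relative) UNDER THE MINIMUM PREMISE** — the body of the leaf `Skeleton.Lemma83Rel c′` (§8 p. 46, GAP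
row G-d55-3) with its guard `AssumptionA D χ` replaced by `‖L(1,χ)‖ ≤ 𝓛⁻¹⁵`; every `c′`. Immediate from the guard-free
form `Repair.Gap.lemma83Rel_free` (the guard is not used). This is exactly the hypothesis `h83` of
`Lemma84.lemma84Rel_pow15_of_lemma83Rel_pow15`. [cite: Zhang2022LandauSiegel, §8 Lemma 8.3 p.46] -/
theorem lemma83Rel_pow15 (c' : ℝ) :
    ∃ C : ℝ, ForAllLarge fun D _ χ => ‖χ.LFunction 1‖ ≤ 1 / Real.log D ^ 15 →
      ∀ j ∈ ({1, 2, 3} : Finset ℕ), ∀ d r : ℕ, 1 ≤ d → 1 ≤ r → ((d * r : ℕ) : ℝ) < bigP D / bigT D ^ 2 →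
        ∃ U : ℂ → ℂ, DifferentiableOn ℂ U {s : ℂ | 9 / 10 < s.re} ∧
          (∀ s : ℂ, 1 < s.re → U s = χ.LFunction s /
              (χ.LFunction (s + betaJ c' D (j + 1)) * χ.LFunction (s + betaJ c' D (j + 2))) *
                xiSeries c' χ j d r s) ∧
          (∀ s : ℂ, 9 / 10 < s.re →
            ‖U s‖ ≤ C * ∏ q ∈ (d * r).primeFactors, (1 + C * (q : ℝ) ^ (-s.re))) ∧
          (∀ s : ℂ, ‖s - 1‖ ≤ 5 * alpha D →
            ‖U s - PiW χ d r‖ ≤ C * (ell D ^ 8)⁻¹ * ∏ q ∈ (d * r).primeFactors, (1 - (q : ℝ)⁻¹)⁻¹) := by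
  obtain ⟨C, h⟩ := Repair.Gap.lemma83Rel_free c'
  exact ⟨C, h.mono fun D _ χ _ _ hS _ => hS⟩

/-- **Lemma 8.3 (relative) under `Repair.Bed.AssumptionAWith E` for EVERY real exponent `E`** (no lower bound on `E`:
the Appendix A chain uses no hypothesis on `L(1,χ)` at all — `Repair.Gap.lemma83Rel_free`; at the printed `E = 2022` the
body is that of the tree theorem `Skeleton.lemma83Rel_holds`, not restated). [cite: Zhang2022LandauSiegel, §8 Lemma 8.3 p.46] -/
theorem lemma83Rel_of_assumptionAWith (c' E : ℝ) :
    ∃ C : ℝ, ForAllLarge fun D _ χ => AssumptionAWith E D χ →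
      ∀ j ∈ ({1, 2, 3} : Finset ℕ), ∀ d r : ℕ, 1 ≤ d → 1 ≤ r → ((d * r : ℕ) : ℝ) < bigP D / bigT D ^ 2 →
        ∃ U : ℂ → ℂ, DifferentiableOn ℂ U {s : ℂ | 9 / 10 < s.re} ∧
          (∀ s : ℂ, 1 < s.re → U s = χ.LFunction s /
              (χ.LFunction (s + betaJ c' D (j + 1)) * χ.LFunction (s + betaJ c' D (j + 2))) *
                xiSeries c' χ j d r s) ∧
          (∀ s : ℂ, 9 / 10 < s.re →
            ‖U s‖ ≤ C * ∏ q ∈ (d * r).primeFactors, (1 + C * (q : ℝ) ^ (-s.re))) ∧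
          (∀ s : ℂ, ‖s - 1‖ ≤ 5 * alpha D →
            ‖U s - PiW χ d r‖ ≤ C * (ell D ^ 8)⁻¹ * ∏ q ∈ (d * r).primeFactors, (1 - (q : ℝ)⁻¹)⁻¹) := by
  obtain ⟨C, h⟩ := Repair.Gap.lemma83Rel_free c'
  exact ⟨C, h.mono fun D _ χ _ _ hS _ => hS⟩

/-- **LEMMA 8.4 (relative) UNDER THE MINIMUM PREMISE, UNCONDITIONAL** — the body of the leaf `Skeleton.Lemma84Rel c′`
(§8 p. 47, GAP row G-adj1-1; the binder `h84` of `theorem1_of_leaves`) with its guard `AssumptionA D χ` replaced by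
`‖L(1,χ)‖ ≤ 𝓛⁻¹⁵`: for `dr < PT⁻²`, `T < y < P`, `μ = 6, 7`, `1 ≤ j ≤ 3`,
`|Σ_{n<y} χ(n)ξ₀ⱼ(n;d,r)n⁻¹(y/n)^{−β_μ}log(y/n) − L′(1,χ)Π(d,r)𝔤_{jμ}(y)| ≤ C𝓛⁻⁶·∏_{q∣dr}(1 − q⁻¹)⁻²`; every `c′`.
The edge `Lemma84.lemma84Rel_pow15_of_lemma83Rel_pow15` (Zhang's proof of Lemma 8.4 with its four (A)-doors at `𝓛⁻¹⁵`,
same `C_fin`) applied to `lemma83Rel_pow15`. [cite: Zhang2022LandauSiegel, §8 Lemma 8.4 p.47]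
[cite: MontgomeryVaughan2007, §6.2, Thm 11.4] -/
theorem lemma84Rel_pow15 (c' : ℝ) :
    ∃ C : ℝ, ForAllLarge fun D _ χ => ‖χ.LFunction 1‖ ≤ 1 / Real.log D ^ 15 →
      ∀ j ∈ ({1, 2, 3} : Finset ℕ), ∀ μ ∈ ({6, 7} : Finset ℕ), ∀ d r : ℕ, 1 ≤ d → 1 ≤ r →
        ((d * r : ℕ) : ℝ) < bigP D / bigT D ^ 2 → ∀ y : ℝ, bigT D < y → y < bigP D →
          ‖(∑ n ∈ Finset.Ico 1 ⌈y⌉₊, χ (n : ZMod D) * xiZero c' D j n d r / (n : ℂ) *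
                ((y / n : ℝ) : ℂ) ^ (-betaMu D μ) * (Real.log (y / n) : ℂ)) -
              deriv χ.LFunction 1 * PiW χ d r * frakgW c' D j μ y‖ ≤
            C * (ell D ^ 6)⁻¹ * (∏ q ∈ (d * r).primeFactors, (1 - (q : ℝ)⁻¹)⁻¹) ^ 2 :=
  Lemma84.lemma84Rel_pow15_of_lemma83Rel_pow15 (lemma83Rel_pow15 c')

/-- **Lemma 8.4 (relative) under `Repair.Bed.AssumptionAWith E`, every real `E ≥ 15`, UNCONDITIONAL** (transfer
`Lemma84.lemma84Rel_of_assumptionAWith_of_lemma83Rel_pow15` at `lemma83Rel_pow15`; at the printed `E = 2022` the body is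
that of the tree theorem `Skeleton.lemma84Rel_holds`, not restated). [cite: Zhang2022LandauSiegel, §8 Lemma 8.4 p.47] -/
theorem lemma84Rel_of_assumptionAWith (c' : ℝ) {E : ℝ} (hE : 15 ≤ E) :
    ∃ C : ℝ, ForAllLarge fun D _ χ => AssumptionAWith E D χ →
      ∀ j ∈ ({1, 2, 3} : Finset ℕ), ∀ μ ∈ ({6, 7} : Finset ℕ), ∀ d r : ℕ, 1 ≤ d → 1 ≤ r →
        ((d * r : ℕ) : ℝ) < bigP D / bigT D ^ 2 → ∀ y : ℝ, bigT D < y → y < bigP D →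
          ‖(∑ n ∈ Finset.Ico 1 ⌈y⌉₊, χ (n : ZMod D) * xiZero c' D j n d r / (n : ℂ) *
                ((y / n : ℝ) : ℂ) ^ (-betaMu D μ) * (Real.log (y / n) : ℂ)) -
              deriv χ.LFunction 1 * PiW χ d r * frakgW c' D j μ y‖ ≤
            C * (ell D ^ 6)⁻¹ * (∏ q ∈ (d * r).primeFactors, (1 - (q : ℝ)⁻¹)⁻¹) ^ 2 :=
  Lemma84.lemma84Rel_of_assumptionAWith_of_lemma83Rel_pow15 (lemma83Rel_pow15 c') hE

end Literature.NumberTheory.LFunctions.Zhang2022.Skeleton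

end
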